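import Literature.NumberTheory.LFunctions.YoshidaWindowGramColumnData
import HarnessLib

/-!
# C∞ rung `R1E` (even sector) — DATA `PFT` part 1/1

Route context: Fourier–Galerkin / Schur-complement certificates of Weil positivity on a window ("format C", C∞ door `weilPositivityOn_of_cinf_pipeline`); supporting stmt-RiemannHypothesis-0098; seat rh-explicit-weil-2 (`cinfemit.py`/`emit_lean2.py`, HOME/rh-explicit-weil-2/gen17/EMITTER-PHASE2.md). Data / bookkeeping only; standard axioms; no RH claim.
-/

set_option autoImplicit false
-- `Summit.RiemannHypothesis.RiemannHypothesis.…` is the layout-mandated namespace (summit = problem name).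
set_option linter.dupNamespace false

namespace Summit.RiemannHypothesis.RiemannHypothesis.Theorems.WeilFormatC

open Literature.NumberTheory.LFunctions

namespace CinfR1E

/-- Packed rows part 1/1 of table `PFT` (word width 355, 4 words). -/
def PFT_P : List ℕ := [
  0x7fffffffffced5c756852df61d3e51ba9b88344d63fec79ec31795527b15f5e76f2271cc9e5b79533cc103b3500000000000002969709218907e45c1c8bc9cffcb9bb19480e6d916dd57646a05c682a4163404d0ed2c268531ffffffffffffffffdd1e99f85686259db40a441fa5e5639f16001ac953087f12767f33ac5275c046e366a7d2400000000000000000001f3064b1650da000d6f4b1830b967e577410d4eb6d99e288f78bcb8e25c79a97a1ca7,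
  0x80000006e0989a4d2ff85d336ba6c54df998534f63437da0954c867c77a93319a726a6fa4ee763c53e7dc3b22ffffffffffa350c81b98c3c06d28b0578bbca5dffa9f8a642096b144ad7b9a6b931f8388bb618dd7e954b9c1e00000000000004e104963e064751cb7c78c72a6f757e6d81eb14c46822259f91349b9231e784696aaf89b2f1bffffffffffffffffba3d33f0ad0c4b3b6814883f4bcac73e2c003592a610fe24ecfe6758a4eb808dc6cd4fa4,
  0x7ffefab44fcd50c1a6db858506ce162c974798e6601acbf9fa1c7b5c72efe14281de98c87d9c8626c7ffda2450000000dc16d135bfc98cbd5e9062cb9b9ef43b39fd83f0cadb22cf215fefce14723d941bff637458da00e481ffffffffff46a19037318780da5160af17794bbff53f14c8412d62895af734d7263f071176c31bafd2a97383c0000000000000a5a5c2486241f9170722f273ff2e6ec652039b645b755d91a8171a0a9058d01343b4b09a14c,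
  0xa6c6f3a6b6671cba0efd4e9d4d0d7ba9bf6d09549a06c9cae4a7b8d7e78ed8cb20266005b04ae475bea589686fffdf5689f9aa1834db70b0a0d9c2c592e8f31ccc03597f3f438f6b8e5dfc28503bd3190fb390c4d8fffb448a0000001b82626934bfe174cdae9b1537e6614d3d8d0df682553219f1dea4cc669c9a9be93b9d8f14f9f70ec8bfffffffffe76ae3ab4296fb0e9f28dd4dc41a26b1ff63cf618bcaa93d8afaf3b79138e64f2dbca99e6081d9a]

end CinfR1E

end Summit.RiemannHypothesis.RiemannHypothesis.Theorems.WeilFormatC
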